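import Summits.AtomisticToContinuum.BoseEinsteinCondensation.Theses.BECGroundStateSOS

/-!
# Sketch (crux-ideate r1, ideator 2 / g2): swap-affinity factorisation of ODLRO and
# "half filling is the least coherent filling"

Props only (nothing proved).  Card: `coherence-minimum-at-half-filling`.
-/

noncomputable section

namespace Summit.AtomisticToContinuum.BoseEinsteinCondensation.Cruxes.LatticeODLROOffHalfFilling.IdeasK2g2

open Literature.MathematicalPhysics.QuantumLattice Literature.Probability.LatticeModels Matrix Finset
open scoped BigOperators

variable (L : ℕ) [NeZero L]

/-- Number of sites `V = L³`. -/
def vol : ℕ := Fintype.card (TorusSite 3 L)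

/-- Sector Hamiltonian: the crux's XY Hamiltonian plus a penalty `4L³ (S³_tot − (N − V/2))²`
(larger than twice the bandwidth), whose ground space is the ground space of the `N`-boson
sector (`S³_tot = N − V/2`); by Perron–Frobenius that sector ground state is unique and
entrywise nonnegative in the occupation basis. -/
def sectorHam (N : ℕ) : Op (TorusSite 3 L) 2 :=
  xxzHamiltonian 1 (torusGraph 3 L) (-1) 0
    + ((4 * L ^ 3 : ℕ) : ℂ) •
      ((totalSpin 1 2 - ((N : ℂ) - (vol L : ℂ) / 2) • (1 : Op (TorusSite 3 L) 2)) ^ 2)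

/-- The sector ground-state functional `ω_N`. -/
def omegaN (N : ℕ) : Op (TorusSite 3 L) 2 →ₗ[ℂ] ℂ := (sectorHam L N).groundStateFunctional

/-- Hopping (one-body) correlator `ρ_N(x,y) = Re ω_N(S¹_xS¹_y + S²_xS²_y) = Re ω_N(a†_x a_y)`
for `x ≠ y` (spin ½: `S¹S¹ + S²S² = ½(S⁺S⁻ + S⁻S⁺)`). -/
def hopCorr (N : ℕ) (x y : TorusSite 3 L) : ℝ :=
  (omegaN L N (siteSpin 1 x 0 * siteSpin 1 y 0 + siteSpin 1 x 1 * siteSpin 1 y 1)).re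

/-- Particle–hole pair density `Z_N(x,y) = ω_N(n_y (1 − n_x))`, `n = ½ + S³`. -/
def pairDensity (N : ℕ) (x y : TorusSite 3 L) : ℝ :=
  (omegaN L N (((1 / 2 : ℂ) • 1 + siteSpin 1 y 2) * ((1 / 2 : ℂ) • 1 - siteSpin 1 x 2))).re

/-- FIRST LEMMA (provable now, any state; equality structure = the swap-affinity identity):
`ρ_N(x,y)² ≤ Z_N(x,y) · Z_N(y,x)`, i.e. the one-body coherence between `x ≠ y` is the pair
density times a number in `[0,1]` — for the Perron ground state that number is EXACTLY the
Bhattacharyya affinity of the laws of the other `N − 1` bosons conditioned on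
(`y` occupied, `x` empty) versus (`x` occupied, `y` empty). -/
def SwapAffinityBound : Prop :=
  ∀ (L : ℕ) [NeZero L] (N : ℕ) (x y : TorusSite 3 L), x ≠ y →
    hopCorr L N x y ^ 2 ≤ pairDensity L N x y * pairDensity L N y x

/-- Off-diagonal planar sum `P_L(N) = Σ_{x ≠ y} ρ_N(x,y)` (`= V·n_N(k=0) − N`). -/
def planarOffDiag (N : ℕ) : ℝ := ∑ x, ∑ y, if x = y then 0 else hopCorr L N x y

/-- Intrinsic coherence `B_L(N) = P_L(N) / (N (V − N))` — the mean swap affinity, in `[0,1]`,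
equal to `1` at `N = 1` and `N = V − 1`; the exact normaliser is `Σ_{x≠y} Z_N(x,y) = N(V−N)`. -/
def coherence (N : ℕ) : ℝ := planarOffDiag L N / ((N : ℝ) * ((vol L : ℝ) - N))

/-- Support (provable now): `0 ≤ B_L(N) ≤ 1` for `0 < N < V`, with `B_L(1) = 1`. -/
def CoherenceBounds : Prop :=
  ∀ (L : ℕ) [NeZero L] (N : ℕ), 0 < N → N < vol L →
    0 ≤ coherence L N ∧ coherence L N ≤ 1 ∧ coherence L 1 = 1

/-- TRANSFER TARGET `C⁺` (MONO): on every even torus, half filling is the least coherent filling. -/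
def CoherenceMinAtHalfFilling : Prop :=
  ∀ k : ℕ, ∀ _hk : 1 ≤ k, ∀ N : ℕ, 1 ≤ N → N + 1 ≤ (2 * k) ^ 3 →
    (haveI : NeZero (2 * k) := ⟨by omega⟩;
      coherence (2 * k) ((2 * k) ^ 3 / 2) ≤ coherence (2 * k) N)

/-- Weaker windowed transfer target (LIP): the coherence is Lipschitz along the filling ladder,
`V · |B_L(N+1) − B_L(N)| ≤ C`, uniformly in even `L` (enough for small `|μ|`). -/
def CoherenceLipschitz (C : ℝ) : Prop :=
  ∀ k : ℕ, ∀ _hk : 1 ≤ k, ∀ N : ℕ, 1 ≤ N → N + 2 ≤ (2 * k) ^ 3 →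
    (haveI : NeZero (2 * k) := ⟨by omega⟩;
      ((2 * k) ^ 3 : ℝ) * |coherence (2 * k) (N + 1) - coherence (2 * k) N| ≤ C)

/-- Line shape (support, provable now from the in-tree KLS midpoint
`kennedy_lieb_shastry_xy_ground_holds 3 _ 1 _`, the sector decomposition of the tracial ground
state of `H_{L,μ}`, and the sector window `n ∈ [ε(μ₀), 1 − ε(μ₀)]` for `|μ| ≤ μ₀ < 3`):
MONO ⇒ the crux, with the explicit bound `liminf ≥ 4n(1−n)·a₀`. -/
def MonoTransfer : Prop :=
  CoherenceMinAtHalfFilling →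
    Summit.AtomisticToContinuum.BoseEinsteinCondensation.Theses.BECGroundStateSOS.LatticeODLROOffHalfFilling

/-- Windowed version: LIP ⇒ the crux (for `μ₀` small in terms of `C` and the KLS constant). -/
def LipTransfer : Prop :=
  ∀ C : ℝ, CoherenceLipschitz C →
    Summit.AtomisticToContinuum.BoseEinsteinCondensation.Theses.BECGroundStateSOS.LatticeODLROOffHalfFilling

end Summit.AtomisticToContinuum.BoseEinsteinCondensation.Cruxes.LatticeODLROOffHalfFilling.IdeasK2g2

end
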